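import Summits.BirchSwinnertonDyer.BirchSwinnertonDyer.Theorems.SignedBaseChangeAnticyclotomicEisensteinDivisibilityAdmdefRootVisibleOfUnitLambda
import Summits.BirchSwinnertonDyer.BirchSwinnertonDyer.Theorems.SignedBaseChangeAnticyclotomicEisensteinDivisibilityAdmdefRootZero
import Summits.BirchSwinnertonDyer.BirchSwinnertonDyer.Theorems.AdditiveKolyvaginRoadLevelDefs
import HarnessLib

/-!
# Line `admdef` on the crux `AnticyclotomicEisensteinDivisibility` (stmt-BirchSwinnertonDyer-20727), LEAD gen 25:
# the CORE ROOT from ONE SEEN ADJACENT ANCHOR — `z_{0,1} ≠ 0` as soon as `λ⁺_1(q)(0)` is a unit at every definite vertex `{q}`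
# adjacent to the root over which some Frobenius of `Gal(K̄/K_∞)` SEES a given non-zero class (Čebotarev supplies such a vertex)

Lead seat bsd-line-sbc-p1 (gen 25), `--supports stmt-BirchSwinnertonDyer-20727`.  This file COMPOSES two landed kernel theorems of the line —
the Čebotarev half of the root dichotomy (`…AdmdefRootZero.exists_admissibleFrob_resOfLe_ne_zero`, LEAD g23: every non-zero class of
`H¹(Γ_{K_0}, E[p])` is visible at an arithmetic Frobenius `φ ∈ D_𝔓 ∩ Gal(K̄/K_∞)` over some `1`-admissible `q`) and the CONVERSE root
criterion (`…AdmdefRootVisibleOfUnitLambda.limitBaseClass_layer_zero_one_ne_zero_of_isUnit_lam`, LEAD g24: a unit `λ_1(q)(0)` plus a non-zero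
element of `H¹(⟨φ⟩, E[p])` forces `z_{0,1} ≠ 0`) — into the statement the registry discussion of `Lines/admdef-lead-g24.md` §8 and
`Lines/admdef-lead-g25.md` §2 needs: **on the frame of cell β, the bottom layer `z_{0,1}` of the limit base class of a signed bipartite system is
NON-ZERO as soon as the rank-0 ANCHOR holds at every definite vertex `{q}` adjacent to the root that is SEEN by a given non-zero class `x` of
`H¹(K, E[p])`** (`x` = a Selmer generator in the corank-one application).  Equivalently: the v22 core-root research text (RV₁)H is implied by
the anchor (unit `λ⁺_1(q)(0)`, i.e. by the BRIDGE's dictionary a unit weighted toric period at level `N·q`) at ONE Čebotarev vertex — the `d = 1`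
instance of the research shape of the `d ≥ 3` anchors (W. Zhang's walk of length one).

* §1 `res_layerZero_ne_zero` — the restriction `H¹(Γ_K, E[p]) → H¹(Γ_{K_0}, E[p])` to the bottom layer `Γ_{K_0} = κ.layerSubgroup 0` (`= ⊤`),
  coefficients respelled `E[(p^1 : ℕ)] → E[p^1]` (`geomTorsion_natCast_pow_one`), is injective (a cocycle of `Γ_K` principal on `Γ_{K_0} = Γ_K` is
  principal; Serre, *Galois Cohomology* I.§2.4).  No definition: the map is the tree's `resH1Hom` along the compatible pair, written out.
* §2 **`limitBaseClass_layer_zero_one_ne_zero_of_seenAnchor`** — `B` a signed bipartite system of sign `ε` at level `N = N_E`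
  (`IsSignedBipartiteSystem`), `z` its limit base class, frame `p ≥ 5`, `ρ̄_{E,p}` onto, `K` imaginary quadratic, every `ℓ ∣ N` split, `p` split,
  `κ` anticyclotomic; `x ∈ H¹(Γ_{K_0}, E[p])` non-zero; anchor: for every `1`-admissible `q`, `𝔓 ∣ v ∋ q`, arithmetic Frobenius
  `φ ∈ D_𝔓 ∩ Gal(K̄/K_∞)` with `res_{⟨φ⟩} x ≠ 0`, `λ_1(q)(0) ∈ ℤ_pˣ`.  THEN `z_{0,1} ≠ 0`.
* §3 `limitBaseClass_layer_zero_one_ne_zero_of_selmerSeenAnchor` — the same with the witness ranging over the non-zero SELMER classes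
  (`selmerGroup (E/K) (p)`, the registry's `Sel_p(E/K)[p]`): «`Sel_p(E/K)[p] ≠ 0` and a unit `λ_1(q)(0)` at every vertex `{q}` whose Frobenius sees a
  non-zero Selmer class ⟹ `z_{0,1} ≠ 0`»; and `…_of_finrank_pos` with the registry's `𝔽_p`-dimension hypothesis (`0 < dim`, in particular `dim = 1`).

Honest framing: theorems only (0 definitions, 0 named facts, 0 `sorry`, standard axioms); nothing is closed.  The anchor hypothesis is the
research input (rank-0 converse mod `p` for the level-raised form `g_q` on cell β — K1-type off the Fouquet–Wan locus); this file only shows that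
at `d = 1` it is needed at ONE Čebotarev vertex adjacent to the root.  BSD / the crux / (RV₁)H are NOT proved by this file.

## References
* [CastellaEtAl2025] F. Castella, C.-Y. Hsu, D. Kundu, Y.-S. Lee, Z. Liu, arXiv:2308.10474v2, Thm. 7.4 (second law, p. 30 L50–L52), (7.2), Thm. 7.5.
* [Howard2006] B. Howard, *Bipartite Euler systems*, J. reine angew. Math. 597 (2006), §2.3 (core vertices), Thm. 3.2.3 (c).
* [WZhang2014] W. Zhang, *Selmer groups and the indivisibility of Heegner points*, Camb. J. Math. 2 (2014), Lemma 7.3, §9 (9.2), proof of Thm. 9.3.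
* [BertoliniDarmon2005] M. Bertolini, H. Darmon, Ann. of Math. 162 (2005), Thm. 3.2.
* [SerreGaloisCohomology] J.-P. Serre, *Galois Cohomology*, I.§2.4 Prop. 9.
-/

-- D-0017: single-problem summit, the namespace repeats the problem name by design.
set_option linter.dupNamespace false
set_option autoImplicit false

noncomputable section

open scoped Classical

open NumberField IsDedekindDomain Field
open Literature.NumberTheory.EllipticCurves Literature.NumberTheory.GaloisRepresentations
open Literature.NumberTheory.EllipticCurves.BertoliniDarmon2005
open Literature.NumberTheory.EllipticCurves.CastellaHsuKunduLeeLiu2025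
open WeierstrassCurve (geomTorsion)
open Summit.BirchSwinnertonDyer.BirchSwinnertonDyer.Theorems

namespace Summit.BirchSwinnertonDyer.BirchSwinnertonDyer.Theorems.SignedBaseChangeAcDivAdmdefCoreRootOfSeenAnchor

/-! ## §1 Restriction to the bottom layer `Γ_{K_0} = ⊤` is injective

No definition is introduced (proof file): the restriction map `H¹(Γ_K, E[(p^1 : ℕ)]) → H¹(Γ_{K_0}, E[p^1])` is written out as the tree's
`resH1Hom` along the compatible pair `(Γ_{K_0} ↪ Γ_K, E[(p^1 : ℕ)] ↪ E[p^1])`, the coefficient map being the identity on points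
(`AddSubgroup.inclusion` of the equality `geomTorsion_natCast_pow_one`). -/

section LayerZero

variable {K : Type} [Field K] [NumberField K] (W : WeierstrassCurve ℚ) {p : ℕ} [Fact p.Prime] (κ : ZpExtension K p)

omit [Fact p.Prime] in
/-- The two spellings of the coefficient module agree: `E[(p^1 : ℕ)] = E[p^1]` (`Nat.cast_pow`).  The registry's `Sel_p(E/K)[p]`
(`AdditiveKoly.Vp`) uses the first, the bipartite systems' bottom classes the second. [folklore] -/
theorem geomTorsion_natCast_pow_one :
    geomTorsion (W.baseChange K) ((p ^ 1 : ℕ) : ℤ) = geomTorsion (W.baseChange K) ((p : ℤ) ^ 1) := by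
  rw [Nat.cast_pow]

/-- **Restriction of a class of `H¹(K, E[p])` (`AdditiveKoly.Vp`, the registry's ambient group of `Sel_p(E/K)[p]`) to the bottom layer
`Γ_{K_0} = κ.layerSubgroup 0` (coefficients respelled `E[(p^1 : ℕ)] → E[p^1]`, the identity on points) is INJECTIVE**: `Γ_{K_0} = Γ_K`, so a
cocycle of `Γ_K` that becomes principal on `Γ_{K_0}` is principal.  The values of this restriction are the bottom-layer classes
`H¹(Γ_{K_0}, E[p])` among which the bipartite systems' `κ_1(m)_0` and `z_{0,1}` live. Serre, *Galois Cohomology*, I.§2.4. [folklore] -/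
theorem res_layerZero_ne_zero {X : AdditiveKoly.Vp W K p} (hX : X ≠ 0) :
    resH1Hom (Literature.NumberTheory.EllipticCurves.subgroupIncl (κ.layerSubgroup 0))
            (AddSubgroup.inclusion (geomTorsion_natCast_pow_one W (K := K) (p := p)).le) (fun _ _ ↦ rfl) X ≠ 0 := by
  intro h0
  apply hX
  obtain ⟨ψ, rfl⟩ := oneCocycleClass_surjective
    (discreteTopRep (absoluteGaloisGroup K) (geomTorsion (W.baseChange K) ((p ^ 1 : ℕ) : ℤ))) X
  obtain ⟨a, ha⟩ := (CocycleCriteria.resH1Hom_oneCocycleClass_eq_zero_iff _ _ _ ψ).mp h0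
  rw [oneCocycleClass_eq_zero_iff]
  refine ⟨⟨(a : WeierstrassCurve.geomPoints (W.baseChange K)), ?_⟩, fun g ↦ ?_⟩
  · rw [geomTorsion_natCast_pow_one]; exact a.2
  · apply Subtype.ext
    have h := congrArg Subtype.val
      (ha ⟨g, SignedBaseChangeAcDivAdmdefRootZero.mem_layerSubgroup_zero κ g⟩)
    rw [AddSubgroup.coe_inclusion, Literature.NumberTheory.EllipticCurves.subgroupIncl_apply] at h
    rw [discreteTopRep_ρ_apply, h]
    rfl

end LayerZero

/-! ## §2 The core root from ONE seen adjacent anchor (Čebotarev ∘ converse root criterion) -/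

section Root

variable {K : Type} [Field K] [NumberField K] {W : WeierstrassCurve ℚ} [W.IsElliptic] [W.IsGloballyMinimal] {p : ℕ} [Fact p.Prime]
  {κ : ZpExtension K p} {γ : absoluteGaloisGroup K} {N : ℕ} {ε : ℤˣ} {B : SignedBipartiteSystem W K p κ}

/-- **The bottom layer of the limit base class is NON-ZERO as soon as the anchor holds at every definite vertex adjacent to the root that is
seen by a given non-zero class.**  Frame of cell β (for Čebotarev): `N = N_E`, `p ≥ 5`, `ρ̄_{E,p}` onto, `K` imaginary quadratic, every `ℓ ∣ N`
split in `K`, `p` split, `κ` anticyclotomic; `B` a signed bipartite system of sign `ε` at level `N` with limit base class `z` (`z_{n,j} = κ_j(1)_n`);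
`x ∈ H¹(Γ_{K_0}, E[p])` non-zero.  ANCHOR: for every `1`-admissible `q`, every `𝔓 ∣ v ∋ q` and every arithmetic Frobenius `φ ∈ D_𝔓 ∩ Gal(K̄/K_∞)`
with `res_{⟨φ⟩} x ≠ 0`, the element `λ_1(q)` has unit constant coefficient.  THEN `z_{0,1} ≠ 0`.  Proof: Čebotarev (Zhang Lemma 7.3 ∕ BD Thm 3.2,
`…AdmdefRootZero`) gives such a `(q, 𝔓, φ)`; the anchor gives the unit; the converse root criterion (second reciprocity law at `(1,1,q)` + the
delta family of `res_{⟨φ⟩} x`, `…AdmdefRootVisibleOfUnitLambda`) gives `z_{0,1} ≠ 0`.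
[cite: WZhang2014, Lemma 7.3, §9 (9.2)] [cite: BertoliniDarmon2005, Thm. 3.2] [cite: CastellaEtAl2025, Thm. 7.4 second law (arXiv:2308.10474v2 p0030 L50–L52), (7.2)]
[cite: Howard2006, §2.3, Thm. 3.2.3 (c)] -/
theorem limitBaseClass_layer_zero_one_ne_zero_of_seenAnchor (hB : IsSignedBipartiteSystem W K p κ γ N ε B)
    {z : Π n j : ℕ, (W.baseChange K).torsionH1Over ((p : ℤ) ^ j) (κ.layerSubgroup n)} (hz : B.IsLimitBaseClass z)
    (hN : (N : ℤ) = W.conductorNorm ℤ) (h5 : 5 ≤ p) (hsurj : W.HasSurjectiveModNGaloisRep p) (hK : IsImaginaryQuadratic K)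
    (hHeeg : ∀ ℓ : ℕ, ℓ.Prime → ℓ ∣ N → ((Ideal.span {(ℓ : ℤ)}).primesOver (𝓞 K)).ncard = 2)
    (hsp : ((Ideal.span {(p : ℤ)}).primesOver (𝓞 K)).ncard = 2) (hκ : κ.IsAnticyclotomic)
    (x : (W.baseChange K).torsionH1Over ((p : ℤ) ^ 1) (κ.layerSubgroup 0)) (hx : x ≠ 0)
    (hanch : ∀ q : ℕ, IsAdmissiblePrime N K (fun ℓ ↦ W.frobeniusTrace ℓ) p 1 q →
      ∀ (v : HeightOneSpectrum (𝓞 K)), ((q : ℕ) : 𝓞 K) ∈ v.asIdeal →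
      ∀ 𝔓 ∈ v.primesAbove, ∀ (φ : absoluteGaloisGroup K) (hφ : φ ∈ κ.kerSubgroup),
        φ ∈ 𝔓.decompositionSubgroup (absoluteGaloisGroup K) → IsArithFrobAt (𝓞 K) φ 𝔓 →
        resOfLe (geomTorsion (W.baseChange K) ((p : ℤ) ^ 1))
          ((Subgroup.zpowers_le.mpr hφ).trans (κ.kerSubgroup_le_layerSubgroup 0)) x ≠ 0 →
        IsUnit (PowerSeries.constantCoeff (B.lam 1 q))) :
    z 0 1 ≠ 0 := by
  have hN' : N = W.conductorNorm ℤ := by exact_mod_cast hN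
  have hH : SatisfiesHeegnerHypothesis (W.conductorNorm ℤ) K := fun ℓ hℓ hℓN ↦ hHeeg ℓ hℓ (hN' ▸ hℓN)
  obtain ⟨q, hadm, v, hqv, 𝔓, h𝔓, φ, hφ, hφD, hφF, hres⟩ :=
    SignedBaseChangeAcDivAdmdefRootZero.exists_admissibleFrob_resOfLe_ne_zero h5 hsurj hK hH hsp κ hκ x hx
  rw [← hN'] at hadm
  exact SignedBaseChangeAcDivAdmdefRootVisibleOfUnitLambda.limitBaseClass_layer_zero_one_ne_zero_of_isUnit_lam hB hz hadm hqv h𝔓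
    hφ hφD hφF _ hres (hanch q hadm v hqv 𝔓 h𝔓 φ hφ hφD hφF hres)

/-! ## §3 The Selmer-currency corollaries (the registry's `Sel_p(E/K)[p]`) -/

/-- **`z_{0,1} ≠ 0` from a non-zero SELMER class and the anchor at the vertices its restriction marks.**  As §2, the witness being a non-zero
class `X` of the Selmer group `Sel_p(E/K)[p] = selmerGroup (E/K) (p)` (restricted to `Γ_{K_0}` along `resH1Hom`, injective by §1), and the anchor
asked at every `1`-admissible `q` over which some arithmetic Frobenius of `Gal(K̄/K_∞)` sees SOME non-zero Selmer class: «a unit `λ_1(q)(0)` at every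
Selmer-seen definite vertex adjacent to the root ⟹ the root class is non-zero».  In corank one (`Sel_p(E/K)[p]` a line) the Selmer-seen vertices
`{q}` are exactly W. Zhang's rank-lowering vertices (`Sel_q = 0`, Zha14 proof of Thm. 9.3 / `…AdmdefSelmerWalk`), where the anchor is the rank-0
converse for the level-raised form `g_q`. [cite: WZhang2014, Lemma 7.3, Thm. 9.3 (proof), §5 (5.1)] [cite: CastellaEtAl2025, Thm. 7.4, (7.2), Thm. 7.5]
[cite: Howard2006, Thm. 3.2.3 (c)] -/
theorem limitBaseClass_layer_zero_one_ne_zero_of_selmerSeenAnchor (hB : IsSignedBipartiteSystem W K p κ γ N ε B)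
    {z : Π n j : ℕ, (W.baseChange K).torsionH1Over ((p : ℤ) ^ j) (κ.layerSubgroup n)} (hz : B.IsLimitBaseClass z)
    (hN : (N : ℤ) = W.conductorNorm ℤ) (h5 : 5 ≤ p) (hsurj : W.HasSurjectiveModNGaloisRep p) (hK : IsImaginaryQuadratic K)
    (hHeeg : ∀ ℓ : ℕ, ℓ.Prime → ℓ ∣ N → ((Ideal.span {(ℓ : ℤ)}).primesOver (𝓞 K)).ncard = 2)
    (hsp : ((Ideal.span {(p : ℤ)}).primesOver (𝓞 K)).ncard = 2) (hκ : κ.IsAnticyclotomic)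
    (hSel : ∃ X ∈ WeierstrassCurve.selmerGroup (W.baseChange K) ((p ^ 1 : ℕ) : ℤ), X ≠ 0)
    (hanch : ∀ q : ℕ, IsAdmissiblePrime N K (fun ℓ ↦ W.frobeniusTrace ℓ) p 1 q →
      ∀ (v : HeightOneSpectrum (𝓞 K)), ((q : ℕ) : 𝓞 K) ∈ v.asIdeal →
      ∀ 𝔓 ∈ v.primesAbove, ∀ (φ : absoluteGaloisGroup K) (hφ : φ ∈ κ.kerSubgroup),
        φ ∈ 𝔓.decompositionSubgroup (absoluteGaloisGroup K) → IsArithFrobAt (𝓞 K) φ 𝔓 →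
        (∃ X ∈ WeierstrassCurve.selmerGroup (W.baseChange K) ((p ^ 1 : ℕ) : ℤ),
          resOfLe (geomTorsion (W.baseChange K) ((p : ℤ) ^ 1))
            ((Subgroup.zpowers_le.mpr hφ).trans (κ.kerSubgroup_le_layerSubgroup 0)) (resH1Hom (Literature.NumberTheory.EllipticCurves.subgroupIncl (κ.layerSubgroup 0))
            (AddSubgroup.inclusion (geomTorsion_natCast_pow_one W (K := K) (p := p)).le) (fun _ _ ↦ rfl) X) ≠ 0) →
        IsUnit (PowerSeries.constantCoeff (B.lam 1 q))) :
    z 0 1 ≠ 0 := by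
  obtain ⟨X, hXsel, hX⟩ := hSel
  exact limitBaseClass_layer_zero_one_ne_zero_of_seenAnchor hB hz hN h5 hsurj hK hHeeg hsp hκ _
    (res_layerZero_ne_zero W κ hX)
    fun q hq v hqv 𝔓 h𝔓 φ hφ hφD hφF hres ↦ hanch q hq v hqv 𝔓 h𝔓 φ hφ hφD hφF ⟨X, hXsel, hres⟩

/-- **The same under the registry's dimension hypothesis** (`0 < dim_𝔽p Sel_p(E/K)[p]`, e.g. the corank-ONE hypothesis `dim = 1` of the v22 text
(RV₁)H = `Signdetour.HeegnerBottomRankOneNS`): a positive-dimensional `𝔽_p`-space has a non-zero vector.  So (RV₁)H ⟸ «unit `λ⁺_1(q)(0)` at every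
Selmer-seen definite vertex adjacent to the root» — the rank-0 anchor at ONE Čebotarev vertex, the `d = 1` case of the research shape of the
`d ≥ 3` anchors. [cite: WZhang2014, Thm. 9.3 (proof), Lemma 7.3] [cite: CastellaEtAl2025, Thm. 7.4, Thm. 7.5] [cite: Howard2006, Thm. 3.2.3 (c)] -/
theorem limitBaseClass_layer_zero_one_ne_zero_of_finrank_pos (hB : IsSignedBipartiteSystem W K p κ γ N ε B)
    {z : Π n j : ℕ, (W.baseChange K).torsionH1Over ((p : ℤ) ^ j) (κ.layerSubgroup n)} (hz : B.IsLimitBaseClass z)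
    (hN : (N : ℤ) = W.conductorNorm ℤ) (h5 : 5 ≤ p) (hsurj : W.HasSurjectiveModNGaloisRep p) (hK : IsImaginaryQuadratic K)
    (hHeeg : ∀ ℓ : ℕ, ℓ.Prime → ℓ ∣ N → ((Ideal.span {(ℓ : ℤ)}).primesOver (𝓞 K)).ncard = 2)
    (hsp : ((Ideal.span {(p : ℤ)}).primesOver (𝓞 K)).ncard = 2) (hκ : κ.IsAnticyclotomic)
    [Module (ZMod p) (AdditiveKoly.Vp W K p)]
    (hdim : 0 < Module.finrank (ZMod p) (AddSubgroup.toZModSubmodule p (WeierstrassCurve.selmerGroup (W.baseChange K) ((p ^ 1 : ℕ) : ℤ))))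
    (hanch : ∀ q : ℕ, IsAdmissiblePrime N K (fun ℓ ↦ W.frobeniusTrace ℓ) p 1 q →
      ∀ (v : HeightOneSpectrum (𝓞 K)), ((q : ℕ) : 𝓞 K) ∈ v.asIdeal →
      ∀ 𝔓 ∈ v.primesAbove, ∀ (φ : absoluteGaloisGroup K) (hφ : φ ∈ κ.kerSubgroup),
        φ ∈ 𝔓.decompositionSubgroup (absoluteGaloisGroup K) → IsArithFrobAt (𝓞 K) φ 𝔓 →
        (∃ X ∈ WeierstrassCurve.selmerGroup (W.baseChange K) ((p ^ 1 : ℕ) : ℤ),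
          resOfLe (geomTorsion (W.baseChange K) ((p : ℤ) ^ 1))
            ((Subgroup.zpowers_le.mpr hφ).trans (κ.kerSubgroup_le_layerSubgroup 0)) (resH1Hom (Literature.NumberTheory.EllipticCurves.subgroupIncl (κ.layerSubgroup 0))
            (AddSubgroup.inclusion (geomTorsion_natCast_pow_one W (K := K) (p := p)).le) (fun _ _ ↦ rfl) X) ≠ 0) →
        IsUnit (PowerSeries.constantCoeff (B.lam 1 q))) :
    z 0 1 ≠ 0 := by
  haveI := Module.finite_of_finrank_pos hdim
  obtain ⟨⟨X, hXsel⟩, hX⟩ := Module.finrank_pos_iff_exists_ne_zero.mp hdim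
  refine limitBaseClass_layer_zero_one_ne_zero_of_selmerSeenAnchor hB hz hN h5 hsurj hK hHeeg hsp hκ ⟨X, ?_, ?_⟩ hanch
  · exact hXsel
  · exact fun h ↦ hX (Subtype.ext h)

end Root

end Summit.BirchSwinnertonDyer.BirchSwinnertonDyer.Theorems.SignedBaseChangeAcDivAdmdefCoreRootOfSeenAnchor

end
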